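import Literature.AlgebraicGeometry.ModuliOfAbelianVarieties.SiegelMarkingTowerFrames
import Literature.NumberTheory.Adeles.IntegralAdelesInverseLimit
import HarnessLib

/-!
# The symplectic frame `k : T̂(A) ⥲ ẑ^{2g}` of a symplectic lift read through a marking: multipliers, and the
# assembled `γ ∈ K_δ(1) = GSp_δ(ẑ)` ([Deligne 1971] 4.12 (b); [Milne 2005] §6 Thm. 6.11, (63); [Lan 2013] Lemma 1.3.6.5)

Topic `AlgebraicGeometry/ModuliOfAbelianVarieties`; namespace
`Literature.AlgebraicGeometry.ModuliOfAbelianVarieties.SiegelAdelicMarking`.  Cell hodgecm-mathlib (D-0151), rung-0 U-DAG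
brick B4, the **(d)-INPUT ADAPTER, FILE 2** (router B-plan1 R58/R59, consumer spec B-p21; director s109), over FILE 1 ★
`SiegelMarkingTowerFrames` (the pairing-free frames `A_M, B_M`) and ★ `IntegralAdelesInverseLimit`
(`GSp_δ(ẑ) = lim GSp_δ(ℤ/M)`).  THEOREMS ONLY (no definition, no named fact, no instance, no `sorry`).  HC_CM is proved
only modulo the 7 printed citations until rung 0 closes.

SETTING as in FILE 1: `X/S` an abelian scheme with level-`N` structure `φ` (`N ≠ 0`), `s : Spec ℂ → S`, fibre `A := X(s)`,
divisor `Θ`, a D3 symplectic lift `Λ` of `(φ, Θ)` of type `δ` at `s` (roots `Λ.ζ`), a T1′ marking `m` of `A` by `[J, a]`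
(`u = m.r`).  The PAIRING BINDER `hpair` (verbatim the binder of ★ B4 (b) `exists_symplecticLift_of_levelReading`, for `m`
and a compatible primitive-root system `ζ′`): the Weil pairing of `Θ` on `M`-torsion points READ at `x̃/M`, `ỹ/M`
through `a` is `ζ′_M ^ E_δ(x, y)` — the D5 identity «algebraic `ē^Θ_M` = analytic pairing» in Siegel normal form, an
INPUT here (so this file stays D5-independent).

* §1 small change-of-root lemmas (`IsPrimitiveRoot`: exponents between two primitive roots, congruences of exponents),
  the value `E_δ(Ā e_i, Ā e_j) = (Āᵀ E_δ Ā)_{ij}` of the reduced type form on frame columns, and the adelic lemma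
  **`adelicCongr_valDiv_of_forall_sub_mem_levelIdeal`**: `γ ≡ A_M (mod M·ẑ)` entrywise ⟹ `γ · x̃/M ≡ (Ā_M x)~/M
  (mod ẑ^{2g})` — «`γ` acts on `M⁻¹ẑ^{2g}/ẑ^{2g} = (ℤ/M)^{2g}` through `Ā_M`» (the `A_M = 1` case is ★ R60-58
  `adelicCongr_coe_mul_inv_iff_of_mem_principalLevelSubgroup`).
* §2 **`exists_frames_multiplier_of_symplecticLift`** — under `hpair`: integer frames `A_M, B_M` AND residues
  `n_M, n′_M ∈ ℤ` satisfying ALL NINE hypotheses `hA hB hAB hBA hn hn′ hnn′ hsymp` of ★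
  `exists_mem_principalLevelSubgroup_one_of_compatible` VERBATIM, plus FILE 1's reading clause; `n_M` is the exponent
  `Λ.ζ_M = ζ′_M ^ n_M` (two primitive roots), and `hsymp` `A_Mᵀ E_δ A_M ≡ n_M E_δ (mod M)` is `Λ.pairing` on the
  basis against `hpair` on the readings.
* §3 **`exists_mem_principalLevelSubgroup_one_frame_of_symplecticLift`** — THE ASSEMBLED FRAME: under `hpair` there
  are `γ ∈ K_δ(1)` and a `ẑ`-unit multiplier `ν` of `γ` such that the WHOLE TOWER of `Λ` is read through `a·γ`:
  `(aγ)⁻¹ ŵ ≡ x̃/M (mod ẑ^{2g}) ⟹ Λ_M(x) = u(w)` ([Deligne1971TravauxShimura] 4.12 (b): the `k_n` «se relèvent en …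
  `k : T̂(B) ⥲ V_ẑ`»; [Milne2005ShimuraVarieties] (63) `η = u ∘ a`); and **`exists_frame_of_symplecticLift`**: for
  `a ∈ K_δ(1)` a frame `k₀ := a·γ ∈ K_δ(1)` — at `M = N` exactly the binder `hP` of ★ B4 (c)
  `exists_principalRep_reading_eq` for the naming `P := Λ.lift N`.

## References
* [Deligne1971TravauxShimura] P. Deligne, *Travaux de Shimura*, Sém. Bourbaki 389 (1971), 4.12 (b) pp. 148–149, 4.16 p. 150.
* [Milne2005ShimuraVarieties] J. S. Milne, *Introduction to Shimura varieties* (2005), §6 Thm. 6.11 p. 74 and p. 75,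
  §12 (63) p. 116.
* [Lan2013PELCompactifications] K.-W. Lan, *Arithmetic compactifications of PEL-type Shimura varieties* (2013), §1.3.6
  Def. 1.3.6.1–1.3.6.2 (pp. 79–80), Lemma 1.3.6.5 (p. 81).
-/

set_option autoImplicit false

noncomputable section

open Matrix CategoryTheory AlgebraicGeometry NumberField IsDedekindDomain
open Literature.AlgebraicGeometry.Motives (AbelianVariety AlgPoints CartierDivisor)
open Literature.AlgebraicGeometry.AbelianSchemes (AbelianSchemeOver)
open Literature.NumberTheory.Adeles (latticeOfGL mem_latticeOfGL_one_iff intCast_mem_integralAdeles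
  exists_mem_principalLevelSubgroup_one_of_compatible)

namespace Literature.AlgebraicGeometry.ModuliOfAbelianVarieties

namespace SiegelAdelicMarking

variable {g : ℕ} {δ : Fin g → ℕ}

/-! ### §1. Change of primitive root; the type form on frame columns; `γ ≡ A_M` acts through `Ā_M` on `M⁻¹ẑ/ẑ` -/

section Lemmas

/-- Two primitive `M`-th roots of unity are powers of each other: `ζ = ζ′ ^ e`.
[cite: Lan2013PELCompactifications, §1.3.6 Lemma 1.3.6.5 (p. 81)] -/
theorem exists_pow_eq_of_isPrimitiveRoot {R : Type*} [CommRing R] [IsDomain R] {M : ℕ} (hM : M ≠ 0) {ζ ζ' : R}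
    (hζ : IsPrimitiveRoot ζ M) (hζ' : IsPrimitiveRoot ζ' M) : ∃ e : ℕ, ζ' ^ e = ζ := by
  haveI : NeZero M := ⟨hM⟩
  obtain ⟨e, -, he⟩ := hζ'.eq_pow_of_pow_eq_one hζ.pow_eq_one
  exact ⟨e, he⟩

/-- Exponents of a primitive `M`-th root agree modulo `M`: `ζ ^ a = ζ ^ b → (M : ℤ) ∣ b − a`.
[cite: Lan2013PELCompactifications, §1.3.6 Lemma 1.3.6.5 (p. 81)] -/
theorem intCast_dvd_sub_of_pow_eq_pow {R : Type*} [CommMonoid R] {M : ℕ} (hM : M ≠ 0) {ζ : R}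
    (hζ : IsPrimitiveRoot ζ M) {a b : ℕ} (h : ζ ^ a = ζ ^ b) : (M : ℤ) ∣ (b : ℤ) - (a : ℤ) := by
  obtain ⟨u, rfl⟩ := hζ.isUnit hM
  have hu : IsPrimitiveRoot u M := IsPrimitiveRoot.coe_units_iff.1 hζ
  have h' : u ^ a = u ^ b := Units.ext (by simpa only [Units.val_pow_eq_pow_val] using h)
  have hmod : a ≡ b [MOD M] := by
    rw [hu.eq_orderOf]; exact pow_eq_pow_iff_modEq.1 h'
  exact Nat.modEq_iff_dvd.1 hmod

/-- The reduced type form on two frame columns: `E_δ(Ā e_i, Ā e_j) = (Āᵀ · E_δ · Ā)_{ij}` in `ℤ/M`.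
[cite: Lan2013PELCompactifications, §1.3.6 Def. 1.3.6.1 (pp. 79–80)] -/
theorem typeFormMod_mulVec_single (M : ℕ) (Abar : Matrix (Fin g ⊕ Fin g) (Fin g ⊕ Fin g) (ZMod M))
    (i j : Fin g ⊕ Fin g) :
    AbelianSchemeOver.typeFormMod δ M (Abar *ᵥ Pi.single i 1) (Abar *ᵥ Pi.single j 1) =
      (Abarᵀ * (typeForm δ).map (Int.castRingHom (ZMod M)) * Abar) i j := by
  have hcol : ∀ (k : Fin g ⊕ Fin g) (l : Fin g ⊕ Fin g), (Abar *ᵥ Pi.single k (1 : ZMod M)) l = Abar l k := by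
    intro k l
    simp [Matrix.mulVec, dotProduct, Pi.single_apply]
  simp only [AbelianSchemeOver.typeFormMod_apply, hcol, Matrix.mul_apply, Matrix.transpose_apply, Matrix.map_apply,
    eq_intCast, Finset.sum_mul]
  rw [Finset.sum_comm]

/-- `(Ā x)ᵢ` has an integer lift congruent to `Σⱼ A_{ij} x̃ⱼ`: `((Ā x) i).val = Σⱼ A i j · (x j).val + M·t`.
[cite: Milne2005ShimuraVarieties, §6 p. 75] -/
private theorem exists_val_mulVec_eq {M : ℕ} [NeZero M] (AM : Matrix (Fin g ⊕ Fin g) (Fin g ⊕ Fin g) ℤ)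
    (x : Fin g ⊕ Fin g → ZMod M) (i : Fin g ⊕ Fin g) :
    ∃ t : ℤ, (((AM.map (Int.castRingHom (ZMod M)) *ᵥ x) i).val : ℤ) =
      (∑ j, AM i j * ((x j).val : ℤ)) + M * t := by
  have hcast : (((∑ j, AM i j * ((x j).val : ℤ) : ℤ)) : ZMod M) =
      ((((AM.map (Int.castRingHom (ZMod M)) *ᵥ x) i).val : ℤ) : ZMod M) := by
    rw [Int.cast_natCast, ZMod.natCast_zmod_val]
    simp [Matrix.mulVec, dotProduct, Matrix.map_apply]
  obtain ⟨t, ht⟩ := (ZMod.intCast_eq_intCast_iff_dvd_sub _ _ M).1 hcast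
  exact ⟨t, by linear_combination ht⟩

/-- **`γ ≡ A_M (mod M·ẑ)` acts on `M⁻¹ẑ^{2g}/ẑ^{2g} = (ℤ/M)^{2g}` through `Ā_M`**: if every entry of `γ − A_M` lies in
`M·ẑ`, then `γ · x̃/M ≡ (Ā_M x)~/M (mod ẑ^{2g})` for every `x ∈ (ℤ/M)^{2g}` (the defect `(γ − A_M)·x̃/M` is integral and
`A_M x̃ ≡ (Ā_M x)~ (mod M)`).  The case `A_M = 1` is ★ R60-58's «`K_δ(M)` acts trivially on `M`-torsion classes».
[cite: Milne2005ShimuraVarieties, §6 Thm. 6.11 p. 74 and p. 75] [cite: Deligne1971TravauxShimura, 4.16 p. 150] -/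
theorem adelicCongr_valDiv_of_forall_sub_mem_levelIdeal {M : ℕ} (hM : M ≠ 0) {γ : GL (Fin g ⊕ Fin g) finAdeleQ}
    {AM : Matrix (Fin g ⊕ Fin g) (Fin g ⊕ Fin g) ℤ}
    (hγ : ∀ i j, (γ : Matrix (Fin g ⊕ Fin g) (Fin g ⊕ Fin g) finAdeleQ) i j - (AM i j : finAdeleQ) ∈ levelIdeal M)
    (x : Fin g ⊕ Fin g → ZMod M) :
    AdelicCongr γ 1 (fun i => ((x i).val : ℚ) / M)
      (fun i => ((((AM.map (Int.castRingHom (ZMod M))) *ᵥ x) i).val : ℚ) / M) := by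
  haveI : NeZero M := ⟨hM⟩
  have hM' : (M : ℚ) ≠ 0 := Nat.cast_ne_zero.2 hM
  intro i
  obtain ⟨t, ht⟩ := exists_val_mulVec_eq AM x i
  -- the defects `γ i j - A i j = M c_j`
  choose c hc hcM using fun j => mem_levelIdeal_iff.1 (hγ i j)
  -- `alg (v / M) * M = alg v`
  have halg : ∀ q : ℚ, (M : finAdeleQ) * algebraMap ℚ finAdeleQ (q / M) = algebraMap ℚ finAdeleQ q := fun q => by
    rw [← map_natCast (algebraMap ℚ finAdeleQ) M, ← map_mul, mul_div_cancel₀ _ hM']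
  rw [Units.val_one, Matrix.one_mulVec, Pi.sub_apply, Matrix.mulVec, dotProduct]
  simp only [adelicVec_apply]
  -- rewrite the reading coordinate: `(Ā x)ᵢ~/M = Σⱼ A i j · x̃ⱼ/M + t` in `ℚ`, then in `𝔸_f`
  have e : ((((AM.map (Int.castRingHom (ZMod M))) *ᵥ x) i).val : ℚ) =
      (∑ j, (AM i j : ℚ) * ((x j).val : ℚ)) + M * t := by exact_mod_cast ht
  have eQ : ((((AM.map (Int.castRingHom (ZMod M))) *ᵥ x) i).val : ℚ) / M =
      (∑ j, (AM i j : ℚ) * (((x j).val : ℚ) / M)) + t := by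
    rw [e, add_div, mul_div_cancel_left₀ _ hM', Finset.sum_div]
    congr 1
    exact Finset.sum_congr rfl fun j _ => mul_div_assoc _ _ _
  have hread : algebraMap ℚ finAdeleQ (((((AM.map (Int.castRingHom (ZMod M))) *ᵥ x) i).val : ℚ) / M) =
      (∑ j, (AM i j : finAdeleQ) * algebraMap ℚ finAdeleQ (((x j).val : ℚ) / M)) + (t : finAdeleQ) := by
    rw [eQ, map_add, map_intCast, map_sum]
    congr 1
    refine Finset.sum_congr rfl fun j _ => ?_
    rw [map_mul, map_intCast]
  rw [hread, ← sub_sub, ← Finset.sum_sub_distrib]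
  refine sub_mem (sum_mem fun j _ => ?_) (intCast_mem_integralAdeles t)
  rw [← sub_mul, ← hcM j, mul_comm (M : finAdeleQ) (c j), mul_assoc, halg, map_natCast]
  exact mul_mem (hc j) (natCast_mem _ _)

end Lemmas

/-! ### §2. Frames AND multipliers under the pairing binder -/

section Multiplier

variable {J : C0pm δ} {a : gspFinAdelic δ}
variable {N : ℕ} {S : Scheme} {X : AbelianSchemeOver S} {s : Spec (.of ℂ) ⟶ S}

/-- **FRAMES AND MULTIPLIERS OF A SYMPLECTIC LIFT READ THROUGH A MARKING** — all nine hypotheses of ★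
`exists_mem_principalLevelSubgroup_one_of_compatible`, plus the reading clause of FILE 1.  Under the pairing binder
`hpair` for `(m, ζ′)` (verbatim ★ B4 (b)'s): integer frames `A_M, B_M` (compatible, mutually inverse mod `M`, reading
`Λ_M` through `a`) and integer residues `n_M, n′_M` (compatible, mutually inverse mod `M`) with
`A_Mᵀ E_δ A_M ≡ n_M E_δ (mod M)` — `n_M` is defined by `Λ.ζ_M = ζ′_M ^ {n_M}`, and the congruence is `Λ.pairing`
(`ē_M(Λ e_i, Λ e_j) = Λ.ζ_M ^ {E_δ(e_i, e_j)}`) against `hpair` (`= ζ′_M ^ {E_δ(Ā e_i, Ā e_j)}`, the `Λ e_i` being READ at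
the columns of `Ā_M`).  [cite: Lan2013PELCompactifications, §1.3.6 Lemma 1.3.6.5 (p. 81) («with `ν(α_n)` the reduction mod `n` of `ν(α̂)`»)]
[cite: Deligne1971TravauxShimura, 4.12 (b) pp. 148–149] [cite: Milne2005ShimuraVarieties, §6 Thm. 6.11 p. 74 and p. 75] -/
theorem exists_frames_multiplier_of_symplecticLift {φ : X.LevelStructure g N}
    {Θ : CartierDivisor (X.fibre s).toAbelianVariety.X.left} (Λ : φ.SymplecticLift s Θ δ)
    (m : SiegelAdelicMarking J a (X.fibre s).toAbelianVariety)
    (ζ' : ℕ → ℂ) (hζ' : ∀ ⦃M : ℕ⦄, N ∣ M → M ≠ 0 → IsPrimitiveRoot (ζ' M) M)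
    (hζ'_pow : ∀ ⦃M : ℕ⦄ (k : ℕ), N ∣ M → M ≠ 0 → k ≠ 0 → ζ' (k * M) ^ k = ζ' M)
    (hpair : ∀ ⦃M : ℕ⦄, N ∣ M → ∀ (hMΩ : (M : ℂ) ≠ 0) (x y : Fin g ⊕ Fin g → ZMod M)
      (P Q : (X.fibre s).toAbelianVariety.torsionPoints ℂ (M : ℤ)),
      (∀ v, AdelicCongr ((a⁻¹ : gspFinAdelic δ) : GL (Fin g ⊕ Fin g) finAdeleQ) 1 v
          (fun i => ((x i).val : ℚ) / M) → (P : (X.fibre s).toAbelianVariety.Points ℂ) = m.r v) →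
      (∀ w, AdelicCongr ((a⁻¹ : gspFinAdelic δ) : GL (Fin g ⊕ Fin g) finAdeleQ) 1 w
          (fun i => ((y i).val : ℚ) / M) → (Q : (X.fibre s).toAbelianVariety.Points ℂ) = m.r w) →
      haveI := AbelianVariety.isDominant_toSchemeHom_zsmul_of_ne_zero (X.fibre s).toAbelianVariety hMΩ
      (X.fibre s).toAbelianVariety.weilPairingLevel Θ P Q = ζ' M ^ (AbelianSchemeOver.typeFormMod δ M x y).val) :
    ∃ (A B : ℕ → Matrix (Fin g ⊕ Fin g) (Fin g ⊕ Fin g) ℤ) (n n' : ℕ → ℤ),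
      (∀ M M' : ℕ, M ≠ 0 → M' ≠ 0 → N ∣ M → M ∣ M' → ∀ i j, (M : ℤ) ∣ A M' i j - A M i j) ∧
      (∀ M M' : ℕ, M ≠ 0 → M' ≠ 0 → N ∣ M → M ∣ M' → ∀ i j, (M : ℤ) ∣ B M' i j - B M i j) ∧
      (∀ M, M ≠ 0 → N ∣ M → ∀ i j, (M : ℤ) ∣ (A M * B M) i j - (1 : Matrix _ _ ℤ) i j) ∧
      (∀ M, M ≠ 0 → N ∣ M → ∀ i j, (M : ℤ) ∣ (B M * A M) i j - (1 : Matrix _ _ ℤ) i j) ∧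
      (∀ M M' : ℕ, M ≠ 0 → M' ≠ 0 → N ∣ M → M ∣ M' → (M : ℤ) ∣ n M' - n M) ∧
      (∀ M M' : ℕ, M ≠ 0 → M' ≠ 0 → N ∣ M → M ∣ M' → (M : ℤ) ∣ n' M' - n' M) ∧
      (∀ M, M ≠ 0 → N ∣ M → (M : ℤ) ∣ n M * n' M - 1) ∧
      (∀ M, M ≠ 0 → N ∣ M → ∀ i j,
        (M : ℤ) ∣ ((A M)ᵀ * typeForm δ * A M) i j - (n M • typeForm δ) i j) ∧
      ∀ ⦃M : ℕ⦄, N ∣ M → M ≠ 0 → ∀ (x : Fin g ⊕ Fin g → ZMod M) (w : Fin g ⊕ Fin g → ℚ),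
        AdelicCongr ((a⁻¹ : gspFinAdelic δ) : GL (Fin g ⊕ Fin g) finAdeleQ) 1 w
            (fun i => ((((A M).map (Int.castRingHom (ZMod M)) *ᵥ x) i).val : ℚ) / M) →
          ((Λ.lift M (Multiplicative.ofAdd x)) : (X.fibre s).toAbelianVariety.Points ℂ) = m.r w := by
  classical
  obtain ⟨A, B, hA, hB, hAB, hBA, hread⟩ := exists_frames_of_symplecticLift Λ m
  /- the exponents `n_M`, `n'_M` between the two root systems -/
  have hexn : ∀ M : ℕ, ∃ e : ℕ, N ∣ M → M ≠ 0 → ζ' M ^ e = Λ.ζ M := fun M => by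
    by_cases h : N ∣ M ∧ M ≠ 0
    · obtain ⟨e, he⟩ := exists_pow_eq_of_isPrimitiveRoot h.2 (Λ.isPrimitiveRoot_ζ h.1 h.2) (hζ' h.1 h.2)
      exact ⟨e, fun _ _ => he⟩
    · exact ⟨0, fun h1 h2 => (h ⟨h1, h2⟩).elim⟩
  have hexn' : ∀ M : ℕ, ∃ e : ℕ, N ∣ M → M ≠ 0 → Λ.ζ M ^ e = ζ' M := fun M => by
    by_cases h : N ∣ M ∧ M ≠ 0
    · obtain ⟨e, he⟩ := exists_pow_eq_of_isPrimitiveRoot h.2 (hζ' h.1 h.2) (Λ.isPrimitiveRoot_ζ h.1 h.2)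
      exact ⟨e, fun _ _ => he⟩
    · exact ⟨0, fun h1 h2 => (h ⟨h1, h2⟩).elim⟩
  choose n hn using hexn
  choose n' hn' using hexn'
  refine ⟨A, B, fun M => (n M : ℤ), fun M => (n' M : ℤ), hA, hB, hAB, hBA, ?_, ?_, ?_, ?_, hread⟩
  · -- hn : compatibility of `n`
    intro M M' hM0 hM'0 hM hMM'
    obtain ⟨k, rfl⟩ := hMM'
    have hk : k ≠ 0 := fun hk => hM'0 (by rw [hk, mul_zero])
    rw [mul_comm M k]
    refine intCast_dvd_sub_of_pow_eq_pow hM0 (hζ' hM hM0) ?_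
    -- `ζ'_M ^ n_M = Λ.ζ_M = Λ.ζ_{kM} ^ k = ζ'_{kM} ^ (n_{kM} k) = ζ'_M ^ n_{kM}`
    rw [hn M hM hM0, ← Λ.ζ_pow k hM hM0 hk, ← hn (k * M) (Dvd.dvd.mul_left hM k) (Nat.mul_ne_zero hk hM0),
      ← pow_mul, pow_mul', hζ'_pow k hM hM0 hk]
  · -- hn' : compatibility of `n'`
    intro M M' hM0 hM'0 hM hMM'
    obtain ⟨k, rfl⟩ := hMM'
    have hk : k ≠ 0 := fun hk => hM'0 (by rw [hk, mul_zero])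
    rw [mul_comm M k]
    refine intCast_dvd_sub_of_pow_eq_pow hM0 (Λ.isPrimitiveRoot_ζ hM hM0) ?_
    rw [hn' M hM hM0, ← hζ'_pow k hM hM0 hk, ← hn' (k * M) (Dvd.dvd.mul_left hM k) (Nat.mul_ne_zero hk hM0),
      ← pow_mul, pow_mul', Λ.ζ_pow k hM hM0 hk]
  · -- hnn' : `n n' ≡ 1`
    intro M hM0 hM
    have h : ζ' M ^ 1 = ζ' M ^ (n M * n' M) := by
      rw [pow_one, pow_mul, hn M hM hM0, hn' M hM hM0]
    have h2 := intCast_dvd_sub_of_pow_eq_pow hM0 (hζ' hM hM0) h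
    rwa [Nat.cast_mul, Nat.cast_one] at h2
  · -- hsymp : `A_Mᵀ E A_M ≡ n_M E (mod M)` from `Λ.pairing` against `hpair`
    intro M hM0 hM i j
    haveI : NeZero M := ⟨hM0⟩
    have hMℂ : (M : ℂ) ≠ 0 := Nat.cast_ne_zero.2 hM0
    set Abar := (A M).map (Int.castRingHom (ZMod M)) with hAbar
    -- the two evaluations of `ē_M(Λ e_i, Λ e_j)`
    have h1 := Λ.pairing hM hMℂ (Pi.single i 1) (Pi.single j 1)
    have h2 := hpair hM hMℂ (Abar *ᵥ Pi.single i 1) (Abar *ᵥ Pi.single j 1)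
      (Λ.lift M (Multiplicative.ofAdd (Pi.single i 1))) (Λ.lift M (Multiplicative.ofAdd (Pi.single j 1)))
      (fun v hv => hread hM hM0 _ v hv) (fun w hw => hread hM hM0 _ w hw)
    have h12 : ζ' M ^ (n M * (AbelianSchemeOver.typeFormMod δ M (Pi.single i 1) (Pi.single j 1)).val) =
        ζ' M ^ (AbelianSchemeOver.typeFormMod δ M (Abar *ᵥ Pi.single i 1) (Abar *ᵥ Pi.single j 1)).val := by
      rw [pow_mul, hn M hM hM0, ← h1]; exact h2
    have hdvd := intCast_dvd_sub_of_pow_eq_pow hM0 (hζ' hM hM0) h12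
    -- read the congruence in `ℤ/M`
    have hzmod : ((n M : ℕ) : ZMod M) * AbelianSchemeOver.typeFormMod δ M (Pi.single i 1) (Pi.single j 1) =
        AbelianSchemeOver.typeFormMod δ M (Abar *ᵥ Pi.single i 1) (Abar *ᵥ Pi.single j 1) := by
      have e := ((ZMod.intCast_eq_intCast_iff_dvd_sub _ _ M).2 hdvd)
      simp only [Nat.cast_mul, Int.cast_mul, Int.cast_natCast, ZMod.natCast_zmod_val] at e
      exact e
    have hE1 : AbelianSchemeOver.typeFormMod δ M (Pi.single i 1) (Pi.single j 1) = ((typeForm δ i j : ℤ) : ZMod M) := by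
      simp [AbelianSchemeOver.typeFormMod_apply, Pi.single_apply]
    rw [typeFormMod_mulVec_single, hE1] at hzmod
    -- back to `ℤ`
    rw [← ZMod.intCast_eq_intCast_iff_dvd_sub]
    have hL : ((((A M)ᵀ * typeForm δ * A M) i j : ℤ) : ZMod M) =
        (Abarᵀ * (typeForm δ).map (Int.castRingHom (ZMod M)) * Abar) i j := by
      rw [hAbar, ← Matrix.transpose_map]
      have e := RingHom.map_matrix_mul ((A M)ᵀ * typeForm δ) (A M) i j (Int.castRingHom (ZMod M))
      rw [eq_intCast] at e
      rw [e, Matrix.map_mul]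
    have hR : (((((n M : ℤ) • typeForm δ) i j : ℤ)) : ZMod M) = ((n M : ℕ) : ZMod M) * ((typeForm δ i j : ℤ) : ZMod M) := by
      rw [Matrix.smul_apply, smul_eq_mul, Int.cast_mul, Int.cast_natCast]
    rw [hL, hR]
    exact hzmod

end Multiplier

/-! ### §3. The assembled frame `γ ∈ K_δ(1)` and the reading of the whole tower through `a·γ` -/

section Frame

variable {J : C0pm δ} {a : gspFinAdelic δ}
variable {N : ℕ} {S : Scheme} {X : AbelianSchemeOver S} {s : Spec (.of ℂ) ⟶ S}

/-- **THE SYMPLECTIC FRAME OF A LIFT READ THROUGH A MARKING** ([Deligne1971TravauxShimura] 4.12 (b): the compatible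
`k_n : B_n ⥲ V_ℤ/nV_ℤ` lift to ONE symplectic `k : T̂(B) ⥲ V_ẑ`; [Milne2005ShimuraVarieties] (63) `η = u ∘ a`).  Under
the pairing binder `hpair` for `(m, ζ′)` there are `γ ∈ K_δ(1) = GSp_δ(ẑ)` and a `ẑ`-unit `ν` with `γᵀ E_δ γ = ν E_δ`
such that the WHOLE TOWER of the lift is the marking's torsion parametrisation read through `a·γ`: for every level
`N ∣ M ≠ 0`, `(a γ)⁻¹ ŵ ≡ x̃/M (mod ẑ^{2g}) ⟹ Λ_M(x) = u(w)`.  Proof: §2 + ★ `exists_mem_principalLevelSubgroup_one_of_compatible`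
(`γ ≡ A_M (mod M·ẑ)` along the tower) + §1 `adelicCongr_valDiv_of_forall_sub_mem_levelIdeal` + FILE 1's reading clause.
[cite: Deligne1971TravauxShimura, 4.12 (b) pp. 148–149 and 4.16 p. 150] [cite: Milne2005ShimuraVarieties, §6 Thm. 6.11 p. 74 and §12 (63) p. 116]
[cite: Lan2013PELCompactifications, §1.3.6 Lemma 1.3.6.5 (p. 81)] -/
theorem exists_mem_principalLevelSubgroup_one_frame_of_symplecticLift (hN : N ≠ 0) {φ : X.LevelStructure g N}
    {Θ : CartierDivisor (X.fibre s).toAbelianVariety.X.left} (Λ : φ.SymplecticLift s Θ δ)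
    (m : SiegelAdelicMarking J a (X.fibre s).toAbelianVariety)
    (ζ' : ℕ → ℂ) (hζ' : ∀ ⦃M : ℕ⦄, N ∣ M → M ≠ 0 → IsPrimitiveRoot (ζ' M) M)
    (hζ'_pow : ∀ ⦃M : ℕ⦄ (k : ℕ), N ∣ M → M ≠ 0 → k ≠ 0 → ζ' (k * M) ^ k = ζ' M)
    (hpair : ∀ ⦃M : ℕ⦄, N ∣ M → ∀ (hMΩ : (M : ℂ) ≠ 0) (x y : Fin g ⊕ Fin g → ZMod M)
      (P Q : (X.fibre s).toAbelianVariety.torsionPoints ℂ (M : ℤ)),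
      (∀ v, AdelicCongr ((a⁻¹ : gspFinAdelic δ) : GL (Fin g ⊕ Fin g) finAdeleQ) 1 v
          (fun i => ((x i).val : ℚ) / M) → (P : (X.fibre s).toAbelianVariety.Points ℂ) = m.r v) →
      (∀ w, AdelicCongr ((a⁻¹ : gspFinAdelic δ) : GL (Fin g ⊕ Fin g) finAdeleQ) 1 w
          (fun i => ((y i).val : ℚ) / M) → (Q : (X.fibre s).toAbelianVariety.Points ℂ) = m.r w) →
      haveI := AbelianVariety.isDominant_toSchemeHom_zsmul_of_ne_zero (X.fibre s).toAbelianVariety hMΩ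
      (X.fibre s).toAbelianVariety.weilPairingLevel Θ P Q = ζ' M ^ (AbelianSchemeOver.typeFormMod δ M x y).val) :
    ∃ (γ : gspFinAdelic δ) (ν : finAdeleQˣ),
      γ ∈ principalLevelSubgroup δ 1 ∧
      IsMultiplier (typeFormOver δ finAdeleQ) (γ : GL (Fin g ⊕ Fin g) finAdeleQ) ν ∧
      (∀ v, Valued.v ((ν : finAdeleQ) v) = 1) ∧
      ∀ ⦃M : ℕ⦄, N ∣ M → M ≠ 0 → ∀ (x : Fin g ⊕ Fin g → ZMod M) (w : Fin g ⊕ Fin g → ℚ),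
        AdelicCongr (((a * γ)⁻¹ : gspFinAdelic δ) : GL (Fin g ⊕ Fin g) finAdeleQ) 1 w
            (fun i => ((x i).val : ℚ) / M) →
          ((Λ.lift M (Multiplicative.ofAdd x)) : (X.fibre s).toAbelianVariety.Points ℂ) = m.r w := by
  obtain ⟨A, B, n, n', hA, hB, hAB, hBA, hn, hn', hnn', hsymp, hread⟩ :=
    exists_frames_multiplier_of_symplecticLift Λ m ζ' hζ' hζ'_pow hpair
  obtain ⟨γ, ν, hγ1, hmult, hν1, -, hγA, -⟩ :=
    exists_mem_principalLevelSubgroup_one_of_compatible δ hN A B n n' hA hB hAB hBA hn hn' hnn' hsymp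
  refine ⟨γ, ν, hγ1, hmult, hν1, fun M hM hM0 x w hw => ?_⟩
  -- `(aγ)⁻¹ ŵ ≡ x̃/M` ⟹ `a⁻¹ ŵ ≡ γ · x̃/M` (multiply by the integral `γ`)
  have hγint : ∀ i j, ((γ : GL (Fin g ⊕ Fin g) finAdeleQ) : Matrix (Fin g ⊕ Fin g) (Fin g ⊕ Fin g) finAdeleQ) i j ∈
      FiniteAdeleRing.integralAdeles (𝓞 ℚ) ℚ := fun i j => isIntegral_of_isCongOne_one hγ1.1 i j
  have hw' : AdelicCongr ((a⁻¹ : gspFinAdelic δ) : GL (Fin g ⊕ Fin g) finAdeleQ) (γ : GL (Fin g ⊕ Fin g) finAdeleQ)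
      w (fun i => ((x i).val : ℚ) / M) := by
    have h := hw.mul_left (u := (γ : GL (Fin g ⊕ Fin g) finAdeleQ)) hγint
    rwa [mul_one, Subgroup.coe_inv, Subgroup.coe_mul, _root_.mul_inv_rev, mul_inv_cancel_left, ← Subgroup.coe_inv] at h
  -- `γ · x̃/M ≡ (Ā_M x)~/M` (§1), then FILE 1's reading clause
  exact hread hM hM0 x w (hw'.trans (adelicCongr_valDiv_of_forall_sub_mem_levelIdeal hM0 (hγA M hM0 hM) x))

/-- **THE FRAME `k₀ ∈ K_δ(1)` OF A LIFT READ THROUGH A LEVEL-ONE MARKING** (`a ∈ K_δ(1)`; the shape consumed by the B4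
(d) head): under the pairing binder there is `k₀ ∈ K_δ(1)` through which the whole tower of `Λ` is read by `m`:
`k₀⁻¹ ŵ ≡ x̃/M (mod ẑ^{2g}) ⟹ Λ_M(x) = u(w)` for every level `N ∣ M ≠ 0` — at `M = N` this is verbatim the binder `hP`
of ★ B4 (c) `exists_principalRep_reading_eq` for the naming `P := Λ.lift N`.
[cite: Deligne1971TravauxShimura, 4.12 (b) pp. 148–149] [cite: Milne2005ShimuraVarieties, §6 Thm. 6.11 p. 74 and §12 (63) p. 116] -/
theorem exists_frame_of_symplecticLift (hN : N ≠ 0) (ha : a ∈ principalLevelSubgroup δ 1)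
    {φ : X.LevelStructure g N} {Θ : CartierDivisor (X.fibre s).toAbelianVariety.X.left} (Λ : φ.SymplecticLift s Θ δ)
    (m : SiegelAdelicMarking J a (X.fibre s).toAbelianVariety)
    (ζ' : ℕ → ℂ) (hζ' : ∀ ⦃M : ℕ⦄, N ∣ M → M ≠ 0 → IsPrimitiveRoot (ζ' M) M)
    (hζ'_pow : ∀ ⦃M : ℕ⦄ (k : ℕ), N ∣ M → M ≠ 0 → k ≠ 0 → ζ' (k * M) ^ k = ζ' M)
    (hpair : ∀ ⦃M : ℕ⦄, N ∣ M → ∀ (hMΩ : (M : ℂ) ≠ 0) (x y : Fin g ⊕ Fin g → ZMod M)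
      (P Q : (X.fibre s).toAbelianVariety.torsionPoints ℂ (M : ℤ)),
      (∀ v, AdelicCongr ((a⁻¹ : gspFinAdelic δ) : GL (Fin g ⊕ Fin g) finAdeleQ) 1 v
          (fun i => ((x i).val : ℚ) / M) → (P : (X.fibre s).toAbelianVariety.Points ℂ) = m.r v) →
      (∀ w, AdelicCongr ((a⁻¹ : gspFinAdelic δ) : GL (Fin g ⊕ Fin g) finAdeleQ) 1 w
          (fun i => ((y i).val : ℚ) / M) → (Q : (X.fibre s).toAbelianVariety.Points ℂ) = m.r w) →
      haveI := AbelianVariety.isDominant_toSchemeHom_zsmul_of_ne_zero (X.fibre s).toAbelianVariety hMΩ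
      (X.fibre s).toAbelianVariety.weilPairingLevel Θ P Q = ζ' M ^ (AbelianSchemeOver.typeFormMod δ M x y).val) :
    ∃ k₀ : gspFinAdelic δ, k₀ ∈ principalLevelSubgroup δ 1 ∧
      ∀ ⦃M : ℕ⦄, N ∣ M → M ≠ 0 → ∀ (x : Fin g ⊕ Fin g → ZMod M) (w : Fin g ⊕ Fin g → ℚ),
        AdelicCongr ((k₀⁻¹ : gspFinAdelic δ) : GL (Fin g ⊕ Fin g) finAdeleQ) 1 w (fun i => ((x i).val : ℚ) / M) →
          ((Λ.lift M (Multiplicative.ofAdd x)) : (X.fibre s).toAbelianVariety.Points ℂ) = m.r w := by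
  obtain ⟨γ, -, hγ1, -, -, hframe⟩ :=
    exists_mem_principalLevelSubgroup_one_frame_of_symplecticLift hN Λ m ζ' hζ' hζ'_pow hpair
  exact ⟨a * γ, mul_mem ha hγ1, hframe⟩

end Frame

end SiegelAdelicMarking

end Literature.AlgebraicGeometry.ModuliOfAbelianVarieties

end
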